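import Literature.Analysis.FluidPDE.PeriodicCylinderSobolevHolder
import HarnessLib

/-!
# "(31) follows easily from (30)": Ferrari's Corollary 1 in the periodic cylinder from her
Proposition 1, and the review record of the merged fact `Ferrari1993_periodicCylinderVorticityH2LogEstimate`

Topic `Literature/Analysis/FluidPDE`. Support file of the chain
`Ferrari1993_periodicCylinderVorticityH2DeltaLogEstimate` (Ferrari's (71), the chain's single
potential-theoretic leaf, `Ferrari1993Prop1DeltaFamily.lean`) `→`
`ShirotaYanagisawa1993_periodicCylinderLogDivCurlEstimate` (`Ferrari1993LogEstimateReduction.lean`) `→`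
`ShirotaYanagisawa1993_periodicCylinderLogEstimate` (`Ferrari1993H3Bound.lean`; Shirota–Yanagisawa
1993, (15) with (17), p. 80) `→ Ferrari1993_periodicCylinderH3Bound → Ferrari1993_periodicCylinderContinuation
→ Ferrari1993_periodicCylinderEulerBKM` (`Ferrari1993ContinuationLeaves.lean`). **Everything here is
proved; the file declares no definition and no named fact.** It contains the step "Proof of
Corollary … (31) follows easily from (30)" of A. B. Ferrari, *On the blow-up of solutions of the
3-D Euler equations in a bounded domain*, Comm. Math. Phys. **155** (1993), p. 286:

* **Proposition 1**, (30) p. 286: for the elliptic system (22) — the four-component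
  Agmon–Douglis–Nirenberg system (21) p. 283 in `v = (w, p)` with data `(φ, χ)`, here in the
  instance `χ = 0`, `v = (w, 0)` of the Proof of Corollary, i.e. `curl w = φ`, `div w = 0` in `Ω`,
  `w·n = 0` on `∂Ω` (`Ω ⊂ ℝ³` bounded, simply connected, of class `C^{2+β}`), `v ∈ H³(Ω)`,
  `φ ∈ H²(Ω)` — `|v|_{W^{1,∞}(Ω)} ≤ C (1 + log⁺ (‖φ‖_{H²(Ω)} / ‖φ‖_{L^∞(Ω)})) ‖φ‖_{L^∞(Ω)}`, in which
  only the **vorticity** `φ = curl v` appears on the right, with its `H²` norm inside the logarithm;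
* **Corollary 1**, (31) p. 286: `|u|_{W^{1,∞}} ≤ C[(1 + log⁺|u|_{H³(Ω)})|ω|_{L^∞} + 1]` — in the tree
  the stationary estimate `ShirotaYanagisawa1993_periodicCylinderLogDivCurlEstimate`: for one velocity
  field `v`, smooth on the closed cylinder, `L`-periodic, divergence free and tangential on the wall,
  `sup_{r<1} ‖Dv‖ ≤ C (‖v‖_{L²(cell)} + 1 + (1 + log⁺ ‖v‖_{H³(cell)}) sup |curl v|)`;
* the step between them, `‖curl v‖_{H²(cell)} ≤ C_S ‖v‖_{H³(cell)}` (the curl is a fixed linear map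
  of `Dv`, `exists_curl_eq_clm_fderiv`, and the derivative loses one Sobolev order,
  `eSobolevDomainNorm_clm_fderivWithin_le`): `exists_eSobolevDomainNorm_curl_le`, whence Corollary 1
  from Proposition 1 with constant `C (1 + log⁺ C_S)` (`log⁺(C_S n) ≤ log⁺ C_S + log⁺ n`,
  `Real.posLog_mul`): `ShirotaYanagisawa1993_periodicCylinderLogDivCurlEstimate_of_vorticityH2`, whose
  hypothesis `hP` is **Proposition 1 in the periodic cylinder, written out** — the same statement,
  character for character, as the conclusion of
  `Ferrari1993_periodicCylinderVorticityH2LogEstimate_of_deltaFamily` (`Ferrari1993Prop1DeltaFamily.lean`,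
  the choice of `δ` (72) p. 293 applied to (71)), so that `Ferrari1993ContinuationLeaves.lean` composes
  the two into `ShirotaYanagisawa1993_periodicCylinderLogDivCurlEstimate_of_deltaLogEstimate : (71) → (31)`.

## Review record (D-0026): the named fact `Ferrari1993_periodicCylinderVorticityH2LogEstimate` is merged back

The hypothesis `hP` first landed here as the named fact
`Ferrari1993_periodicCylinderVorticityH2LogEstimate` — Proposition 1 in the periodic cylinder —,
minted as the first decomposition child of `ShirotaYanagisawa1993_periodicCylinderLogEstimate` (whose
prove seat had triaged it XL: "the fact itself is the Green-matrix potential theory up to the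
curved wall"); its own prove seat triaged it XL again and decomposed it in turn (the `δ`-family (71),
`Ferrari1993Prop1DeltaFamily.lean`, and below that a Green-matrix fact, since merged back into (71),
`PeriodicCylinderGreenMatrix.lean`). Decompositions do not recurse; the split review, with Ferrari
pp. 283–293 and Shirota–Yanagisawa pp. 77–81 open, found:

* the fact is **faithful** to Prop. 1 (30) (rendering below) and is **neither open nor misstated**;
* it is **not provable inline**: the printed proof, pp. 286–293, runs on top of two imported
  theories — Thm 3 p. 285 ("a specialization of Theorem 10.5 of [3]", the Agmon–Douglis–Nirenberg
  `W^{1,p}` a-priori estimate, used in (47), (62)–(63), (68) and on p. 293) and Thm 4 p. 285 ("a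
  specialization of Theorem 1.1 of [11]", Solonnikov's Green matrix with
  `|D^β 𝒢(x, y)| ≤ C|x − y|^{-2-|β|}` up to the boundary, (28)–(29), used as (33)–(34)) —, neither of
  which Mathlib or this tree has (the tree's `L²` regularity for the Neumann problem in the cylinder,
  `PeriodicCylinderNeumann*.lean`, cannot give an `L^∞`-endpoint estimate; a reflection across the
  curved wall `{r = 1}` preserves either the curl or the divergence of a field, not both);
  Shirota–Yanagisawa's proof (18)–(23) p. 81 imports the same two theories ("Theorem 5.1 of [8]",
  "Theorem 10.5 in [1]");
* as a decomposition child it is **mis-cut**: it is Corollary 1 strengthened to Proposition 1, from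
  which its parent follows by the proved 40-line step of this file, so it carries the whole
  difficulty of the parent; since `Ferrari1993Prop1DeltaFamily.lean` it is moreover a proved 50-line
  consequence of (71), and the parent is reached from (71) without it
  (`ShirotaYanagisawa1993_periodicCylinderLogDivCurlEstimate_of_deltaFamily ∘
  ShirotaYanagisawa1993_periodicCylinderDeltaLogDivCurlEstimate_of_vorticityH2DeltaFamily`,
  `PeriodicCylinderLogDivCurl.lean`, `Ferrari1993Prop1DeltaFamily.lean`); it had no other consumer.

It was therefore **merged back** into the proof obligation of (71): the `def` is deleted; its body,
unchanged, is the written-out hypothesis `hP` of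
`ShirotaYanagisawa1993_periodicCylinderLogDivCurlEstimate_of_vorticityH2` here and the written-out
conclusion of `Ferrari1993_periodicCylinderVorticityH2LogEstimate_of_deltaFamily` there (names and
proofs unchanged); the two unreferenced compositions
`ShirotaYanagisawa1993_periodicCylinderLogEstimate_of_vorticityH2` and
`Ferrari1993_periodicCylinderH3Bound_of_energyInequality_of_vorticityH2` are dropped (subsumed by
`ShirotaYanagisawa1993_periodicCylinderLogEstimate_of_divCurl`,
`Ferrari1993_periodicCylinderH3Bound_of_energyInequality_of_divCurl` and the assemblies of
`Ferrari1993ContinuationLeaves.lean`). Nothing is weakened, no statement of the chain changes, and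
its trust base is unchanged: (71) (with `KatoLai1984_periodicCylinderUniformExistence` for the
continuation theorem).

## Faithfulness of the written-out Proposition 1 (hypothesis `hP`)

* (30) is rendered in the "+1" normalisation of Cor. 1 / S.–Y. (15), `C (e + 1 + (1 + log⁺ N) A)`,
  which the printed scale-invariant form implies
  (`(1 + log⁺(N/A)) A ≤ A + A log⁺ N + A log⁺(1/A) ≤ A + A log⁺ N + e⁻¹`) and which avoids the
  quotient `N/A`; otherwise exactly as `ShirotaYanagisawa1993_periodicCylinderLogDivCurlEstimate`
  (fields `C^∞` on the closed cylinder — smoother than the printed `v ∈ H³`, `φ ∈ H²`, so nothing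
  printed is exceeded — `L`-periodic, divergence free in `{r < 1}`, tangential on `{r = 1}`;
  `|v|_{W^{1,∞}}` as the supremum over `{r < 1}` of the operator norm of the classical derivative,
  the `L^∞` part of the `W^{1,∞}` norm being recovered downstream from the energy,
  `norm_le_of_eLpNorm_two_le_of_norm_fderiv_le`; `‖φ‖_{H²}` by the tree's
  `eSobolevDomainNorm 2 2 (cylinderCell L) volume (curl v)`; monotone right-hand side, so `N, e, A`
  enter as upper bounds with `‖curl v‖_{H²(cell)} ≤ N` in place of Cor. 1's `‖v‖_{H³(cell)} ≤ n`).
  Printed for simply connected domains, where (22) has no harmonic solutions and no `L²` term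
  occurs; the periodic cylinder `{r ≤ 1} × ℝ/Lℤ` is a compact flat manifold with boundary whose
  harmonic fields are the multiples of `e_z` (for `v = c e_z`: `curl v = 0`, `Dv = 0`,
  `‖v‖_{L²(cell)} = |c| (πL)^{1/2}`), controlled as in Shirota–Yanagisawa (17) by the `L²` term `e` —
  the adaptation caveat of the whole chain (`Ferrari1993_periodicCylinderH3Bound`; Luo–Hou 2014
  §4.4, Chen–Hou 2021 §9).
* Not here: Proposition 1 itself — it is the conclusion of
  `Ferrari1993_periodicCylinderVorticityH2LogEstimate_of_deltaFamily` from the named fact (71), whose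
  discharge (the potential theory up to the curved wall; hypothesis-form predicate and derivation
  plan in `PeriodicCylinderGreenMatrix.lean`) is the open obligation of the chain. Also in the tree,
  for a proof along Beale–Kato–Majda's whole-space lines (near part by the Hölder seminorm of the
  vorticity, (13)–(14) p. 65 of B.–K.–M. 1984) rather than Ferrari's: the Sobolev step
  `[curl v]_{C^{0,1/2}({r<1})} ≤ C ‖v‖_{H³(cell)}` is proved as `exists_holderOnWith_curl_unitCylinder`
  (`PeriodicCylinderSobolevHolder.lean`), and the whole-space kernel computations (37), (48) as
  `NewtonKernelLogPotential.lean`.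

Mathlib/tree search: `lean search 'LogDivCurl|Prop1|VorticityH2'` — the chain above only; used:
`exists_curl_eq_clm_fderiv`, `eSobolevDomainNorm_clm_fderivWithin_le`
(`PeriodicCylinderSobolevHolder`), `exists_eSobolevDomainNorm_fderiv_le` (`SobolevNormSmoothMaps`),
`SobolevApprox.eSobolevDomainNorm_congr`, `closure_unitCylinder_mem_nhds`; Mathlib's `Real.posLog`,
`Real.posLog_mul`, `Real.posLog_nonneg`.
-/

noncomputable section

open MeasureTheory Set Function Filter Topology TopologicalSpace WithLp
open scoped ContDiff NNReal ENNReal InnerProductSpace RealInnerProductSpace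

namespace Literature.Analysis.FluidPDE

open Literature.Analysis.FunctionSpaces

/-- **The vorticity of a field smooth on the closed cylinder has `H²(cell)` norm bounded by the
`H³(cell)` norm of the field**: `‖curl v‖_{H²(cell)} ≤ C_S ‖v‖_{H³(cell)}` with `C_S` depending only
on `L` (the curl is a fixed linear map `Λ` of the derivative, `exists_curl_eq_clm_fderiv`; on the
open cell it agrees with `Λ ∘ D_K v`, `K` the closed cylinder, whose norm is bounded by
`eSobolevDomainNorm_clm_fderivWithin_le`; the step "(31) follows easily from (30)" of Ferrari 1993,
p. 286). [folklore] -/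
theorem exists_eSobolevDomainNorm_curl_le (L : ℝ) :
    ∃ C : ℝ≥0, ∀ (v : EuclideanSpace ℝ (Fin 3) → EuclideanSpace ℝ (Fin 3)),
      ContDiffOn ℝ ∞ v (closure (unitCylinder : Set (EuclideanSpace ℝ (Fin 3)))) → ∀ k : ℕ,
        eSobolevDomainNorm k 2 (cylinderCell L) volume (curl v) ≤
          C * eSobolevDomainNorm (k + 1) 2 (cylinderCell L) volume v := by
  obtain ⟨Λ, hΛ⟩ := exists_curl_eq_clm_fderiv
  obtain ⟨C₁, hC₁⟩ := exists_eSobolevDomainNorm_fderiv_le (E' := EuclideanSpace ℝ (Fin 3))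
    (F := EuclideanSpace ℝ (Fin 3)) (μ := (volume : Measure (EuclideanSpace ℝ (Fin 3))))
    (Ω := cylinderCell L) (p := 2) one_le_two
  refine ⟨‖Λ‖₊ * C₁, fun v hv k => ?_⟩
  have heq : EqOn (curl v)
      (fun x => Λ (fderivWithin ℝ v (closure (unitCylinder : Set (EuclideanSpace ℝ (Fin 3)))) x))
      (cylinderCell L) := fun x hx => by
    rw [hΛ]
    show Λ (fderiv ℝ v x) = Λ (fderivWithin ℝ v _ x)
    rw [fderivWithin_of_mem_nhds (closure_unitCylinder_mem_nhds (cylinderCell_le_unitCylinder L hx))]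
  rw [SobolevApprox.eSobolevDomainNorm_congr heq]
  refine (eSobolevDomainNorm_clm_fderivWithin_le hC₁ Λ hv k).trans (le_of_eq ?_)
  push_cast
  ring

/-- **"(31) follows easily from (30)": `ShirotaYanagisawa1993_periodicCylinderLogDivCurlEstimate`
(Ferrari's Corollary 1 in the periodic cylinder) from Ferrari's Proposition 1** (Ferrari 1993,
"Proof of Corollary", p. 286, with `φ = ω = curl u`). The hypothesis `hP` is **Proposition 1, (30)
p. 286, in the periodic cylinder, written out** (for `Ω ⊂ ℝ³` bounded, simply connected, of class
`C^{2+β}`, `v ∈ H³(Ω)` solving (22) with data `φ ∈ H²(Ω)`, `χ = 0`: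
`|v|_{W^{1,∞}(Ω)} ≤ C (1 + log⁺(‖φ‖_{H²(Ω)}/‖φ‖_{L^∞(Ω)})) ‖φ‖_{L^∞(Ω)}`; proof pp. 286–293 through
Solonnikov's Green matrix (33)–(34), the splitting (71) and the choice of `δ` (72); Shirota–Yanagisawa
1993, (15) with (17)–(23) pp. 80–81 for general topology, the harmonic components bounded by the
energy `‖u‖₀`; rendering — "+1" normalisation `C (e + 1 + (1 + log⁺ N) A)` with upper bounds
`N ≥ ‖curl v‖_{H²(cell)}`, `e ≥ ‖v‖_{L²(cell)}`, `A ≥ sup_{r<1} |curl v|`, fields `C^∞` on the closed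
cylinder, `L`-periodic, divergence free, tangential, adaptation caveat of the chain — as in the module
docstring; it is, character for character, the conclusion of
`Ferrari1993_periodicCylinderVorticityH2LogEstimate_of_deltaFamily`, formerly the named fact
`Ferrari1993_periodicCylinderVorticityH2LogEstimate` merged back by the split review). Proof: feed
`‖curl v‖_{H²(cell)} ≤ C_S n` for `n ≥ ‖v‖_{H³(cell)}` (`exists_eSobolevDomainNorm_curl_le`) into `hP`
and use `log⁺(C_S n) ≤ log⁺ C_S + log⁺ n` (`Real.posLog_mul`), i.e.
`1 + log⁺(C_S n) ≤ (1 + log⁺ C_S)(1 + log⁺ n)`; the constant becomes `C (1 + log⁺ C_S)`. [cite: Ferrari1993, Cor. 1 (31) from Prop. 1 (30), p. 286]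
[cite: ShirotaYanagisawa1993, (15) with (17) p. 80 (general topology)] -/
theorem ShirotaYanagisawa1993_periodicCylinderLogDivCurlEstimate_of_vorticityH2
    (hP : ∀ (L : ℝ) (_hL : 0 < L), ∃ C : ℝ≥0,
      ∀ (v : EuclideanSpace ℝ (Fin 3) → EuclideanSpace ℝ (Fin 3))
        (_hv : ContDiffOn ℝ ∞ v (closure (unitCylinder : Set (EuclideanSpace ℝ (Fin 3)))))
        (_hper : IsAxiallyPeriodic L v)
        (_hdiv : ∀ x ∈ (unitCylinder : Set (EuclideanSpace ℝ (Fin 3))),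
          VectorCalculus.divergence v x = 0)
        (_hslip : ∀ x ∈ frontier (unitCylinder : Set (EuclideanSpace ℝ (Fin 3))), ⟪v x, eR x⟫ = 0)
        (N e A : ℝ≥0)
        (_hN : eSobolevDomainNorm 2 2 (cylinderCell L) volume (curl v) ≤ N)
        (_he : eLpNorm v 2 (volume.restrict (cylinderCell L : Set (EuclideanSpace ℝ (Fin 3)))) ≤ e)
        (_hA : ∀ x ∈ (unitCylinder : Set (EuclideanSpace ℝ (Fin 3))), ‖curl v x‖ ≤ A),
      ∀ x ∈ (unitCylinder : Set (EuclideanSpace ℝ (Fin 3))),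
        ‖fderiv ℝ v x‖ ≤ C * (e + 1 + (1 + Real.posLog N) * A)) :
    ShirotaYanagisawa1993_periodicCylinderLogDivCurlEstimate := by
  intro L hL
  obtain ⟨C, hC⟩ := hP L hL
  obtain ⟨C_S, hS⟩ := exists_eSobolevDomainNorm_curl_le L
  set p : ℝ≥0 := ⟨Real.posLog C_S, Real.posLog_nonneg⟩ with hp
  have hpc : ((p : ℝ≥0) : ℝ) = Real.posLog C_S := rfl
  refine ⟨C * (1 + p), ?_⟩
  intro v hv hper hdiv hslip n e A hn he hA x hx
  have hN : eSobolevDomainNorm 2 2 (cylinderCell L) volume (curl v) ≤ (C_S * n : ℝ≥0) := by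
    push_cast
    exact (hS v hv 2).trans (mul_le_mul' le_rfl hn)
  have key := hC v hv hper hdiv hslip (C_S * n) e A hN he hA x hx
  refine key.trans ?_
  have hlog : Real.posLog ((C_S : ℝ) * n) ≤ Real.posLog C_S + Real.posLog n := Real.posLog_mul
  have h0 : 0 ≤ Real.posLog (C_S : ℝ) := Real.posLog_nonneg
  have h1 : 0 ≤ Real.posLog (n : ℝ) := Real.posLog_nonneg
  have hA0 : (0 : ℝ) ≤ A := A.coe_nonneg
  have he0 : (0 : ℝ) ≤ e := e.coe_nonneg
  have hC0 : (0 : ℝ) ≤ C := C.coe_nonneg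
  push_cast
  rw [hpc]
  have hfac : (1 + Real.posLog ((C_S : ℝ) * n)) * A ≤
      (1 + Real.posLog C_S) * ((1 + Real.posLog n) * A) := by
    have h2 : 1 + Real.posLog ((C_S : ℝ) * n) ≤ (1 + Real.posLog C_S) * (1 + Real.posLog n) := by
      nlinarith [hlog, mul_nonneg h0 h1]
    calc (1 + Real.posLog ((C_S : ℝ) * n)) * A
        ≤ (1 + Real.posLog C_S) * (1 + Real.posLog n) * A := mul_le_mul_of_nonneg_right h2 hA0
      _ = _ := by ring
  calc (C : ℝ) * (e + 1 + (1 + Real.posLog ((C_S : ℝ) * n)) * A)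
      ≤ C * ((1 + Real.posLog C_S) * (e + 1) +
          (1 + Real.posLog C_S) * ((1 + Real.posLog n) * A)) := by
        refine mul_le_mul_of_nonneg_left (add_le_add ?_ hfac) hC0
        nlinarith
    _ = C * (1 + Real.posLog C_S) * (e + 1 + (1 + Real.posLog n) * A) := by ring

end Literature.Analysis.FluidPDE
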